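import Literature.AnabelianGeometry.EtaleTheta.Discharge.Sec4Prop42SubRootCoverLaws
import Literature.AlgebraicGeometry.Frobenioids.PadicKummerRemark221Tri
import Literature.AlgebraicGeometry.Frobenioids.PadicKummerSettingProofs
import HarnessLib

/-!
# [EtTh] Prop. 4.2 (iii)/(iv): the laws `hL` (GAP G-w4d044-1) and `hE` (GAP G-w4d044-2) AT THE FAITHFUL
# [FrdII] Def. 2.2 (ii) READING — reduced to [FrdII] Rmk. 2.2.1 (layer L1, PROVED) plus root-free dictionary clauses

S. Mochizuki, *The étale theta function and its Frobenioid-theoretic manifestations*, Publ. RIMS **45** (2009)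
[MochizukiEtTh2009], §4, Prop. 4.2 (iii)/(iv), proof PDF p.90 (printed p.316): L14–17 «it follows from the
"(N, H_⊙, f|_{A_N})-saturated-ness" condition in the statement of assertion (iii) [cf. also Proposition 3.4, (ii)]
that the pull-back `∈ O^×(A_N)` … of any element `∈ O^×(A_⊙)` … admits an `N`-th root» (the law `hL`), and p.90
L10–11 «[FrdII], Remark 2.2.1 [concerning the issue of (N, H_⊙^{bs-fld})-saturation]» (the law `hE`).
S. Mochizuki, *The geometry of Frobenioids II*, Kyushu J. Math. **62** (2008) [MochizukiFrdII2008], Def. 2.2 (ii)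
p.17 ((a) `μ_N`-saturated, (b) `A_D` Galois, (c) the cohomological condition on `H ↠ H_A`) and Rmk. 2.2.1 p.18
(«there exists a pull-back morphism `A″ → A′` … such that `A″` is `(N, H)`-saturated»; «we have a natural
isomorphism `(O^□(A) ⊇) O^□(A)^H ⥲ O^□(L^H)`»; «any element `f ∈ O^□(A)^H` admits an `N`-th root `g ∈ O^□(A)`»).
[cite: MochizukiEtTh2009, Prop 4.2 p.90] [cite: MochizukiFrdII2008, Rmk 2.2.1 p.18]

abc-iut cell, layer L2, DAG nodes `EtTh:Prop4.2(iii)` / `EtTh:Prop4.2(iv)`, plan/L2/SUBDAG-EtTh-Prop42.md rows L05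
(`UnitRootsUpstairs`) and L01b (`SaturatedRefinement`); seat abc-iut-w4-d044 (gen 4), the lineage that filed the two
laws as GAP-LEDGER rows **G-w4d044-1** (`hL`, the «roots of constants» law, binder of
`Prop42Sub.unitRootsUpstairs_of_constantRoots`, p420977) and **G-w4d044-2** (`hE`, the «saturating refinement» law,
binder of `Prop42Sub.saturatedRefinement_of_laws`, p421793).  Both rows say «prove in-cone at the L1↔L2 hull
identification»: the `(N, H_⊙^{bs-fld})`-saturation slot `BiKummerSetting.IsNHSaturatedBsFld` of the §4 setting is a
FREE field (Def. 4.1 (iii)(a), TODO-merge), and plan/L2/VNEXT-CENSUS-L2.md row B2 books its FAITHFUL READING — an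
assignment `ctx : C → PadicKummer.Def22Context` of [FrdII] Def. 2.2 contexts with the reading law
`S.IsNHSaturatedBsFld S.HodotBsFld A N ↔ PadicKummer.IsNHSaturated (ctx A) N` (the shape of abc-iut-w6-d047's
`isNHSaturatedBsFld_iff_of_def22Iso`, `BiKummerThm44SubNHSatDef22.lean`, which REWROTE T44-L15b that way).

PROOF-ONLY companion (0 `def`s, no instance, no new `Prop` fact; nothing landed is edited or restated).  AT THAT
READING the two laws are NOT [EtTh]-internal any more:
* **§A, `hL`.** `Prop42Sub.constantRoots_of_def22Reading` — `hL` ⟸ abc-iut-L1-t7's named fact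
  `PadicKummer.SaturatedInvariantsAdmitRoots (ctx A″) N` ([FrdII] Rmk. 2.2.1 «any `f ∈ O^□(A)^H` admits an `N`-th
  root»; a THEOREM at the arithmetic contexts, `Def22Context.saturatedInvariantsAdmitRoots_ofLocalField`, L1-t7)
  for the Frobenius-trivial objects over `A_⊙`, plus ONE root-free hull clause `hconst`: «the pull-back along
  `A″^bs ⟶ A_⊙^bs` of a `Div_B`-trivial element of `B(A_⊙^bs)` [a CONSTANT unit, [EtTh] Prop. 3.4 (ii)] is the image
  of an `(H_⊙)_{A″}`-invariant element of `O^□(A″)`» ([FrdII] Rmk. 2.2.1 «`O^□(A)^H ⥲ O^□(L^H)`»: `A_⊙`'s constants lie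
  in the `H_⊙^{bs-fld}`-fixed field) through a monoid map `ιO A : O^□(A) → B(A^bs)` ([FrdI] Thm. 5.2 (ii): units
  of the model Frobenioid are `Div_B`-trivial rational functions).  `unitRootsUpstairs_of_def22Reading`: row L05.
* **§B, `hE`.** `Prop42Sub.refinementLaw_of_def22Reading` — `hE` ⟸ the [FrdII] Rmk. 2.2.1 existence schema READ IN
  `C` («every `A′` has a pull-back morphism from an `A″` with `ctx A″` `(N, H)`-saturated»; L1's
  `PadicKummer.ExistsSaturatedPullback`, a THEOREM at the arithmetic binding, `existsSaturatedPullback_ofLocalField`,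
  abc-iut-L1-t7) plus the reading laws of Def. 2.2 (ii)(a) `Kummer.IsMuSaturated N (ctx A).O → S.IsMuSaturated A N`
  and (b) `(ctx A).isGalois → S.IsGalois A`.
* **§C, the node floor re-keyed.** `Prop42Sub.prop42_iii_iv_mkOfModelCanonical_of_def22Reading`: this lineage's joint
  floor `prop42_iii_iv_mkOfModelCanonical_of_laws` (p428253: [EtTh] Prop. 4.2 (iii) ∧ (iv) AS TYPED at
  abc-iut-L2-t9's canonical model instance ⟸ {`Φ` divisorial, `hDSpull`, `hR`, `hE`, `hS`, `hL`}) with `hE`, `hL`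
  REPLACED by {the Def. 2.2 reading dictionary} ∪ {[FrdII] Rmk. 2.2.1 ×2 BY NAME}.
* **§D, arithmetic binding.** `Prop42Sub.constantRoots_of_def22Reading_arith` /
  `prop42_iv_mkOfModelCanonical_of_def22Reading_arith`: when the context of each Frobenius-trivial `A″` over `A_⊙`
  is ISOMORPHIC ([FrdII] Def. 2.2 context isomorphism, abc-iut-L1-d4's `Def22Context.Iso`) to the arithmetic context
  `Def22Context.ofLocalField L H hH O^□_L` of a finite Galois `L ⊆ K̄` with `Gal(K̄/L) ≤ H` (`K` a field of
  characteristic `0` with a valuative structure), the Rmk. 2.2.1 input is DISCHARGED in the kernel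
  (`saturatedInvariantsAdmitRoots_ofLocalField_box` transported by `Def22Context.Iso.saturatedInvariantsAdmitRoots_iff`):
  Prop. 4.2 (iv) AS TYPED at the canonical model ⟸ {`Φ` divisorial, reading law, `hconst`, arithmetic binding}.

What is NOT done here (honest census, for the booked MERGE — VNEXT B2, holder abc-iut-w6-d047): the context family
`ctx` itself (base-field functor `D → E = B(G_K)`, `Aut_E(A_E)`, `res`, `outer`, descended action on `O^×(A)`), the
reading law, the map `ιO` with `hconst`, and the arithmetic binding are DATA/definitions of that merge; here they
are explicit binders, exactly as in `BiKummerThm44SubNHSatDef22.lean`.  GAP rows G-w4d044-1 and G-w4d044-2 thus read: «=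
dictionary clauses of the B2 merge + [FrdII] Rmk. 2.2.1 (PROVED, layer L1)»; they stay OPEN until the merge lands.
HONEST FRAMING: [EtTh]/[FrdII] are refereed prerequisite papers; typed ≠ proved for the binders; nothing here bears
on, or takes a side on, the disputed [IUTchIII] Cor. 3.12; nothing here asserts abc proved or refuted.
-/

namespace Literature.AnabelianGeometry.EtaleTheta

open CategoryTheory Opposite Literature.AlgebraicGeometry.Frobenioids

universe u₀ v₀ u v w

namespace BiKummerSetting

section General

variable {K : Type u₀} [Field K]
  {X : SemiGraphs.TemperedArithmeticGroup.{u₀} K} {D₀ : Type u₀} [Category.{v₀} D₀]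
  {V : FrdIMonoidStub.{w}} {T : RealifiedDivisorMonoids (D₀ := D₀) V} {D : Type u} [Category.{v} D]
  {VD : FrdICatStub.{u, v, w} D} (S : BiKummerSetting X T D VD)

namespace Prop42Sub

/-! ### §A. The roots-of-constants law `hL` (G-w4d044-1) at the Def. 2.2 reading -/

/-- **`hL` (GAP G-w4d044-1) AT THE FAITHFUL [FrdII] Def. 2.2 (ii) READING ⟸ [FrdII] Rmk. 2.2.1 + a root-free hull
clause.**  If the setting's `(N, H_⊙^{bs-fld})`-saturation slot implies [FrdII] Def. 2.2 (ii) saturation of a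
Def. 2.2 context `ctx A` (`hNH`, reading law), every Frobenius-trivial `A″` over `A_⊙` satisfies Rmk. 2.2.1's
«`(N,H)`-saturated ⇒ every `H`-invariant element of `O^□(A″)` has an `N`-th root in `O^□(A″)`» (`h221`, the named
fact `PadicKummer.SaturatedInvariantsAdmitRoots`, PROVED at the arithmetic contexts in layer L1), and the pull-back
of every `Div_B`-trivial (= constant, [EtTh] Prop. 3.4 (ii)) element of `B(A_⊙^bs)` to `A″` is the image under
`ιO A″ : O^□(A″) → B(A″^bs)` of an `(H_⊙)_{A″}`-invariant element (`hconst`), then `hL` holds: the root is taken in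
`O^□(A″)` and mapped to `B(A″^bs)`.  Printed step p.90 L14–17. [cite: MochizukiEtTh2009, Prop 4.2 p.90] -/
theorem constantRoots_of_def22Reading (ctx : S.C → PadicKummer.Def22Context)
    (hNH : ∀ (A : S.C) (N : ℕ+),
      S.IsNHSaturatedBsFld S.HodotBsFld A N → PadicKummer.IsNHSaturated (ctx A) N)
    (h221 : ∀ (A'' : S.C) (N : ℕ+), (A''.base ⟶ S.Aodot.base) → S.IsFrobeniusTrivial A'' →
      PadicKummer.SaturatedInvariantsAdmitRoots (ctx A'') N)
    (ιO : ∀ A : S.C, (ctx A).O →* S.tf.ratFnFunctor.obj (op A.base))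
    (hconst : ∀ (A'' : S.C) (g : A''.base ⟶ S.Aodot.base) (ξ : S.tf.ratFnFunctor.obj (op S.Aodot.base)),
      S.IsFrobeniusTrivial A'' →
      divB S.tf.divisorMonoid S.tf.ratFnFunctor S.tf.divBNatTrans (op S.Aodot.base) ξ = 1 →
        ∃ f : (ctx A'').O, (∀ h : (ctx A'').HA, (h : (ctx A'').AutE) • f = f) ∧
          ιO A'' f = pull S.tf.ratFnFunctor g ξ) :
    ∀ (A'' : S.C) (N : ℕ+) (g : A''.base ⟶ S.Aodot.base) (ξ : S.tf.ratFnFunctor.obj (op S.Aodot.base)),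
      S.IsFrobeniusTrivial A'' → S.IsNHSaturatedBsFld S.HodotBsFld A'' N →
      divB S.tf.divisorMonoid S.tf.ratFnFunctor S.tf.divBNatTrans (op S.Aodot.base) ξ = 1 →
        ∃ ζ : S.tf.ratFnFunctor.obj (op A''.base), ζ ^ (N : ℕ) = pull S.tf.ratFnFunctor g ξ := by
  intro A'' N g ξ hft hsat hξ
  obtain ⟨f, hf, hfe⟩ := hconst A'' g ξ hft hξ
  obtain ⟨r, hr⟩ := h221 A'' N g hft (hNH A'' N hsat) f hf
  exact ⟨ιO A'' r, by rw [← map_pow, hr, hfe]⟩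

variable (pullFrac : ∀ {A A' : S.C} (_ : A' ⟶ A), S.biratUnits A → S.biratUnits A')

/-- **Row L05 `UnitRootsUpstairs` AT THE Def. 2.2 READING** (modulo `Φ` divisorial, `B` group-like): this
lineage's `unitRootsUpstairs_of_constantRoots` (the transport half of p.90 L14–17 in the model Frobenioid) with
its law `hL` supplied by `constantRoots_of_def22Reading`. [cite: MochizukiEtTh2009, Prop 4.2 p.90] -/
theorem unitRootsUpstairs_of_def22Reading
    (hΦd : Objectwise (fun M _ => IsDivisorial M) S.tf.divisorMonoid)
    (hBg : Objectwise (fun M _ => IsGroupLike M) S.tf.ratFnFunctor)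
    (ctx : S.C → PadicKummer.Def22Context)
    (hNH : ∀ (A : S.C) (N : ℕ+),
      S.IsNHSaturatedBsFld S.HodotBsFld A N → PadicKummer.IsNHSaturated (ctx A) N)
    (h221 : ∀ (A'' : S.C) (N : ℕ+), (A''.base ⟶ S.Aodot.base) → S.IsFrobeniusTrivial A'' →
      PadicKummer.SaturatedInvariantsAdmitRoots (ctx A'') N)
    (ιO : ∀ A : S.C, (ctx A).O →* S.tf.ratFnFunctor.obj (op A.base))
    (hconst : ∀ (A'' : S.C) (g : A''.base ⟶ S.Aodot.base) (ξ : S.tf.ratFnFunctor.obj (op S.Aodot.base)),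
      S.IsFrobeniusTrivial A'' →
      divB S.tf.divisorMonoid S.tf.ratFnFunctor S.tf.divBNatTrans (op S.Aodot.base) ξ = 1 →
        ∃ f : (ctx A'').O, (∀ h : (ctx A'').HA, (h : (ctx A'').AutE) • f = f) ∧
          ιO A'' f = pull S.tf.ratFnFunctor g ξ) :
    UnitRootsUpstairs S pullFrac :=
  unitRootsUpstairs_of_constantRoots S pullFrac hΦd hBg (constantRoots_of_def22Reading S ctx hNH h221 ιO hconst)

/-! ### §B. The saturating-refinement law `hE` (G-w4d044-2) at the Def. 2.2 reading -/

/-- **`hE` (GAP G-w4d044-2) AT THE FAITHFUL [FrdII] Def. 2.2 (ii) READING ⟸ [FrdII] Rmk. 2.2.1 (existence of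
saturated pull-backs) + the reading laws of Def. 2.2 (ii)(a)(b).**  If Def. 2.2 (ii) saturation of `ctx A`
implies the setting's slot (`hNH'`), clause (b) «`A_D` is Galois» reads `S.IsGalois` (`hgal`) and clause (a)
«`μ_N`-saturated» reads `S.IsMuSaturated` (`hmu`), then Rmk. 2.2.1 read in `C` — «given `A′ ∈ Ob(C)` … there
exists a pull-back morphism `A″ → A′` in `C` such that `A″` is `(N, H)`-saturated» (`hex`; L1's named fact
`PadicKummer.ExistsSaturatedPullback`, PROVED at the arithmetic binding) — yields `hE` verbatim.
Printed step p.90 L10–11. [cite: MochizukiEtTh2009, Prop 4.2 p.90] -/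
theorem refinementLaw_of_def22Reading (ctx : S.C → PadicKummer.Def22Context)
    (hNH' : ∀ (A : S.C) (N : ℕ+),
      PadicKummer.IsNHSaturated (ctx A) N → S.IsNHSaturatedBsFld S.HodotBsFld A N)
    (hgal : ∀ A : S.C, (ctx A).isGalois → S.IsGalois A)
    (hmu : ∀ (A : S.C) (N : ℕ+), Kummer.IsMuSaturated (N : ℕ) (ctx A).O → S.IsMuSaturated A N)
    (hex : ∀ (A' : S.C) (N : ℕ+),
      ∃ (A'' : S.C) (ψ : A'' ⟶ A'), S.IsPullback ψ ∧ PadicKummer.IsNHSaturated (ctx A'') N) :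
    ∀ (N : ℕ+) (A' : S.C), S.IsFrobeniusTrivial A' → S.IsGalois A' →
      ∃ (A'' : S.C) (ψ : A'' ⟶ A'), S.IsPullback ψ ∧ S.IsGalois A'' ∧ S.IsMuSaturated A'' N ∧
        S.IsNHSaturatedBsFld S.HodotBsFld A'' N := by
  intro N A' _ _
  obtain ⟨A'', ψ, hψ, hsat⟩ := hex A' N
  exact ⟨A'', ψ, hψ, hgal A'' hsat.galois, hmu A'' N hsat.muSaturated, hNH' A'' N hsat⟩

/-- **The existence input `hex` IS [FrdII] Rmk. 2.2.1's named-fact schema read in `C`.**  When the objects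
of `C` live in universe `0` (layer L1's `PadicKummer` files are universe-`0`), `hex` is literally abc-iut-L1-t7's
`PadicKummer.ExistsSaturatedPullback` for the object type `S.C`, the one-point index of open normal subgroups
(`H := H_⊙^{bs-fld}` is fixed in §4) and «there is a pull-back morphism `A″ → A′`» := `∃ ψ : A″ ⟶ A′, S.IsPullback ψ`
— the schema abc-iut-L1-t7 DISCHARGED at the arithmetic binding (`existsSaturatedPullback_ofLocalField`).
[cite: MochizukiFrdII2008, Rmk 2.2.1 p.18] -/
theorem hex_of_existsSaturatedPullback {V' : FrdIMonoidStub.{0}} {T' : RealifiedDivisorMonoids (D₀ := D₀) V'}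
    {D' : Type} [Category.{v} D'] {VD' : FrdICatStub.{0, v, 0} D'} (S' : BiKummerSetting X T' D' VD')
    (ctx : S'.C → PadicKummer.Def22Context)
    (h : PadicKummer.ExistsSaturatedPullback S'.C PUnit (fun A'' A' => ∃ ψ : A'' ⟶ A', S'.IsPullback ψ)
      (fun A _ => ctx A)) :
    ∀ (A' : S'.C) (N : ℕ+),
      ∃ (A'' : S'.C) (ψ : A'' ⟶ A'), S'.IsPullback ψ ∧ PadicKummer.IsNHSaturated (ctx A'') N := by
  intro A' N
  obtain ⟨A'', ⟨ψ, hψ⟩, hsat⟩ := h A' N PUnit.unit N.pos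
  exact ⟨A'', ψ, hψ, hsat⟩

end Prop42Sub

/-! ### §C. The joint node floor of `EtTh:Prop4.2(iii)`/`(iv)` at the canonical model, re-keyed on the reading -/

section Canonical

variable (X) (tf : TemperedFrobenioid T D VD) (hZ : tf.monoidType = MonoidType.Z)
  (hP : ∀ A : Dᵒᵖ, IsPerfect (tf.Φ.carrier A)) (IG : D → Prop) (gS : ∀ A : D, IG A → (X.Pi →* Aut A))
  (gSs : ∀ (A : D) (h : IG A), Function.Surjective (gS A h))
  (NH : Subgroup (Field.absoluteGaloisGroup K) → tf.category → ℕ+ → Prop) (A₀ : tf.category)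
  (hA₀ : PreFrobenioid.IsFrobeniusTrivial tf.toElem A₀) (hA₀' : IG A₀.base)

/-- **[EtTh] Prop. 4.2 (iv) AS TYPED at the canonical model instance, modulo `Φ` divisorial and the Def. 2.2
READING of the chosen saturation predicate `NH`** (reading law `hNH`, [FrdII] Rmk. 2.2.1 root fact `h221` for the
Frobenius-trivial objects over `A_⊙`, hull map `ιO` with its constants clause `hconst`) — this lineage's
`prop42_iv_mkOfModelCanonical_of_constantRoots` (p420977) with `hL` from `constantRoots_of_def22Reading`.
[cite: MochizukiEtTh2009, Prop 4.2 p.89] -/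
theorem prop42_iv_mkOfModelCanonical_of_def22Reading
    (hΦd : Objectwise (fun M _ => IsDivisorial M) tf.divisorMonoid)
    (ctx : tf.category → PadicKummer.Def22Context)
    (hNH : ∀ (A : tf.category) (N : ℕ+),
      NH (mkOfModelCanonical X tf hZ hP IG gS gSs NH A₀ hA₀ hA₀').HodotBsFld A N →
        PadicKummer.IsNHSaturated (ctx A) N)
    (h221 : ∀ (A'' : tf.category) (N : ℕ+), (A''.base ⟶ A₀.base) →
      PreFrobenioid.IsFrobeniusTrivial tf.toElem A'' → PadicKummer.SaturatedInvariantsAdmitRoots (ctx A'') N)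
    (ιO : ∀ A : tf.category, (ctx A).O →* tf.ratFnFunctor.obj (op A.base))
    (hconst : ∀ (A'' : tf.category) (g : A''.base ⟶ A₀.base) (ξ : tf.ratFnFunctor.obj (op A₀.base)),
      PreFrobenioid.IsFrobeniusTrivial tf.toElem A'' →
      divB tf.divisorMonoid tf.ratFnFunctor tf.divBNatTrans (op A₀.base) ξ = 1 →
        ∃ f : (ctx A'').O, (∀ h : (ctx A'').HA, (h : (ctx A'').AutE) • f = f) ∧
          ιO A'' f = pull tf.ratFnFunctor g ξ) :
    (mkOfModelCanonical X tf hZ hP IG gS gSs NH A₀ hA₀ hA₀').Prop42_iv (fun φ x => tf.pullFracModel φ x) :=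
  prop42_iv_mkOfModelCanonical_of_constantRoots X tf hZ hP IG gS gSs NH A₀ hA₀ hA₀' hΦd
    (Prop42Sub.constantRoots_of_def22Reading (mkOfModelCanonical X tf hZ hP IG gS gSs NH A₀ hA₀ hA₀')
      ctx hNH h221 ιO hconst)

/-- **[EtTh] Prop. 4.2 (iii) ∧ (iv) AS TYPED at the canonical model — the JOINT NODE FLOOR with the two GAP laws
`hL` (G-w4d044-1), `hE` (G-w4d044-2) REPLACED by the Def. 2.2 reading**: ⟸ {`Φ` divisorial, `hDSpull` ([FrdI]
Prop. 4.1 (iii)), `hR` (ERRATUM E2 root law, G-w4d044-3 — abc-iut-L2-t3 lineage), `hS` (Def. 4.1 (ii)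
naturality)} ∪ {reading law both ways `hNH`/`hNH'`, (a) `hmu`, (b) `hgal`, hull map `ιO` + `hconst`} ∪ {[FrdII]
Rmk. 2.2.1 ×2 BY NAME: `h221` (`SaturatedInvariantsAdmitRoots`), `hex` (existence of saturated pull-backs read in
`C`)} — this lineage's `Prop42Sub.prop42_iii_iv_mkOfModelCanonical_of_laws` (p428253).
[cite: MochizukiEtTh2009, Prop 4.2 p.88] -/
theorem Prop42Sub.prop42_iii_iv_mkOfModelCanonical_of_def22Reading
    (hΦd : Objectwise (fun M _ => IsDivisorial M) tf.divisorMonoid)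
    (hDSpull : ∀ {A A' : D} (e : A' ⟶ A) {a b : tf.Φ.carrier (op A)},
      (∀ x : tf.Φ.carrier (op A), x ∣ a → x ∣ b → x = 1) →
        ∀ y : tf.Φ.carrier (op A'), y ∣ pull tf.divisorMonoid e a → y ∣ pull tf.divisorMonoid e b → y = 1)
    (hR : ∀ (N : ℕ+) (A : D), IG A → ∀ f : tf.ratFnFunctor.obj (op A),
      ∃ (A' : D) (_ : IG A') (b : A' ⟶ A) (g : tf.ratFnFunctor.obj (op A')),
        g ^ (N : ℕ) = pull tf.ratFnFunctor b f)
    (hS : ∀ ⦃A B : D⦄ (hA : IG A) (hB : IG B) (b : B ⟶ A),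
      ∃ c : X.Pi, ∀ g : X.Pi, (gS B hB g).hom ≫ b = b ≫ (gS A hA (c * g * c⁻¹)).hom)
    (ctx : tf.category → PadicKummer.Def22Context)
    (hNH : ∀ (A : tf.category) (N : ℕ+),
      NH (mkOfModelCanonical X tf hZ hP IG gS gSs NH A₀ hA₀ hA₀').HodotBsFld A N →
        PadicKummer.IsNHSaturated (ctx A) N)
    (hNH' : ∀ (A : tf.category) (N : ℕ+), PadicKummer.IsNHSaturated (ctx A) N →
      NH (mkOfModelCanonical X tf hZ hP IG gS gSs NH A₀ hA₀ hA₀').HodotBsFld A N)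
    (hgal : ∀ A : tf.category, (ctx A).isGalois → IG A.base)
    (hmu : ∀ (A : tf.category) (N : ℕ+), Kummer.IsMuSaturated (N : ℕ) (ctx A).O → tf.IsMuSaturated A N)
    (hex : ∀ (A' : tf.category) (N : ℕ+), ∃ (A'' : tf.category) (ψ : A'' ⟶ A'),
      PreFrobenioid.IsPullbackMorphism tf.toElem ψ ∧ PadicKummer.IsNHSaturated (ctx A'') N)
    (h221 : ∀ (A'' : tf.category) (N : ℕ+), (A''.base ⟶ A₀.base) →
      PreFrobenioid.IsFrobeniusTrivial tf.toElem A'' → PadicKummer.SaturatedInvariantsAdmitRoots (ctx A'') N)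
    (ιO : ∀ A : tf.category, (ctx A).O →* tf.ratFnFunctor.obj (op A.base))
    (hconst : ∀ (A'' : tf.category) (g : A''.base ⟶ A₀.base) (ξ : tf.ratFnFunctor.obj (op A₀.base)),
      PreFrobenioid.IsFrobeniusTrivial tf.toElem A'' →
      divB tf.divisorMonoid tf.ratFnFunctor tf.divBNatTrans (op A₀.base) ξ = 1 →
        ∃ f : (ctx A'').O, (∀ h : (ctx A'').HA, (h : (ctx A'').AutE) • f = f) ∧
          ιO A'' f = pull tf.ratFnFunctor g ξ) :
    (mkOfModelCanonical X tf hZ hP IG gS gSs NH A₀ hA₀ hA₀').Prop42_iii (fun {_ _} φ x => tf.pullFracModel φ x) ∧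
      (mkOfModelCanonical X tf hZ hP IG gS gSs NH A₀ hA₀ hA₀').Prop42_iv (fun φ x => tf.pullFracModel φ x) :=
  Prop42Sub.prop42_iii_iv_mkOfModelCanonical_of_laws X tf hZ hP IG gS gSs NH A₀ hA₀ hA₀' hΦd hDSpull hR
    (Prop42Sub.refinementLaw_of_def22Reading (mkOfModelCanonical X tf hZ hP IG gS gSs NH A₀ hA₀ hA₀')
      ctx hNH' hgal hmu hex)
    hS
    (Prop42Sub.constantRoots_of_def22Reading (mkOfModelCanonical X tf hZ hP IG gS gSs NH A₀ hA₀ hA₀')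
      ctx hNH h221 ιO hconst)

end Canonical

end General

/-! ### §D. The arithmetic binding: Rmk. 2.2.1 DISCHARGED by layer L1 at `Def22Context.ofLocalField` -/

section Arithmetic

open Literature.NumberTheory.GaloisRepresentations.LocalWeilDatum (galFixing)

variable {K : Type} [Field K] [ValuativeRel K] [CharZero K]
  {X : SemiGraphs.TemperedArithmeticGroup.{0} K} {D₀ : Type} [Category.{v₀} D₀]
  {V : FrdIMonoidStub.{w}} {T : RealifiedDivisorMonoids (D₀ := D₀) V} {D : Type u} [Category.{v} D]
  {VD : FrdICatStub.{u, v, w} D} (S : BiKummerSetting X T D VD)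
  (H : Subgroup (Field.absoluteGaloisGroup K)) [H.Normal] (hH : IsOpen (H : Set (Field.absoluteGaloisGroup K)))
  (fs : Prop)

/-- **`hL` (G-w4d044-1) AT THE Def. 2.2 READING WITH THE ARITHMETIC BINDING — the Rmk. 2.2.1 input discharged.**
Over a field `K` of characteristic `0` with a valuative structure: if the context of every Frobenius-trivial `A″`
over `A_⊙` is isomorphic ([FrdII] Def. 2.2 context isomorphism) to the arithmetic context
`Def22Context.ofLocalField L H hH O^□_L` ([FrdII] Rmk. 2.2.1 «`A_E = Spec(L)`», `O^□_L = O^⊳_L` or `O^×_L` per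
Def. 2.2 (iii)) of a finite Galois `L ⊆ K̄` with `Gal(K̄/L) ≤ H` (`harith`), then `h221` is abc-iut-L1-t7's
THEOREM `saturatedInvariantsAdmitRoots_ofLocalField_box` transported along the isomorphism (abc-iut-L1-d4's
`Def22Context.Iso.saturatedInvariantsAdmitRoots_iff`), and `hL` ⟸ {reading law, `hconst`, arithmetic binding}.
[cite: MochizukiFrdII2008, Rmk 2.2.1 p.18] -/
theorem Prop42Sub.constantRoots_of_def22Reading_arith (ctx : S.C → PadicKummer.Def22Context)
    (hNH : ∀ (A : S.C) (N : ℕ+),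
      S.IsNHSaturatedBsFld S.HodotBsFld A N → PadicKummer.IsNHSaturated (ctx A) N)
    (harith : ∀ (A'' : S.C), (A''.base ⟶ S.Aodot.base) → S.IsFrobeniusTrivial A'' →
      ∃ (L : IntermediateField K (AlgebraicClosure K)) (_ : FiniteDimensional K L) (_ : Normal K L),
        galFixing K L ≤ H ∧ Nonempty (PadicKummer.Def22Context.Iso (ctx A'')
          (PadicKummer.Def22Context.ofLocalField L H hH (PadicKummer.boxStableSubmonoid K L fs))))
    (ιO : ∀ A : S.C, (ctx A).O →* S.tf.ratFnFunctor.obj (op A.base))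
    (hconst : ∀ (A'' : S.C) (g : A''.base ⟶ S.Aodot.base) (ξ : S.tf.ratFnFunctor.obj (op S.Aodot.base)),
      S.IsFrobeniusTrivial A'' →
      divB S.tf.divisorMonoid S.tf.ratFnFunctor S.tf.divBNatTrans (op S.Aodot.base) ξ = 1 →
        ∃ f : (ctx A'').O, (∀ h : (ctx A'').HA, (h : (ctx A'').AutE) • f = f) ∧
          ιO A'' f = pull S.tf.ratFnFunctor g ξ) :
    ∀ (A'' : S.C) (N : ℕ+) (g : A''.base ⟶ S.Aodot.base) (ξ : S.tf.ratFnFunctor.obj (op S.Aodot.base)),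
      S.IsFrobeniusTrivial A'' → S.IsNHSaturatedBsFld S.HodotBsFld A'' N →
      divB S.tf.divisorMonoid S.tf.ratFnFunctor S.tf.divBNatTrans (op S.Aodot.base) ξ = 1 →
        ∃ ζ : S.tf.ratFnFunctor.obj (op A''.base), ζ ^ (N : ℕ) = pull S.tf.ratFnFunctor g ξ := by
  refine Prop42Sub.constantRoots_of_def22Reading S ctx hNH (fun A'' N g hft => ?_) ιO hconst
  obtain ⟨L, _, _, hHL, ⟨e⟩⟩ := harith A'' g hft
  exact (e.saturatedInvariantsAdmitRoots_iff (N : ℕ)).mpr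
    (PadicKummer.Def22Context.saturatedInvariantsAdmitRoots_ofLocalField_box L (N : ℕ) H hH fs hHL)

section Canonical

variable (X) (tf : TemperedFrobenioid T D VD) (hZ : tf.monoidType = MonoidType.Z)
  (hP : ∀ A : Dᵒᵖ, IsPerfect (tf.Φ.carrier A)) (IG : D → Prop) (gS : ∀ A : D, IG A → (X.Pi →* Aut A))
  (gSs : ∀ (A : D) (h : IG A), Function.Surjective (gS A h))
  (NH : Subgroup (Field.absoluteGaloisGroup K) → tf.category → ℕ+ → Prop) (A₀ : tf.category)
  (hA₀ : PreFrobenioid.IsFrobeniusTrivial tf.toElem A₀) (hA₀' : IG A₀.base)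

/-- **[EtTh] Prop. 4.2 (iv) AS TYPED at the canonical model instance, with the Rmk. 2.2.1 input DISCHARGED by
layer L1**: ⟸ {`Φ` divisorial, reading law `hNH`, hull map `ιO` + constants clause `hconst`, arithmetic binding
`harith` of the contexts of the Frobenius-trivial objects over `A_⊙`} — no `N`-th-root law is assumed anywhere.
[cite: MochizukiEtTh2009, Prop 4.2 p.89] -/
theorem prop42_iv_mkOfModelCanonical_of_def22Reading_arith
    (hΦd : Objectwise (fun M _ => IsDivisorial M) tf.divisorMonoid)
    (ctx : tf.category → PadicKummer.Def22Context)
    (hNH : ∀ (A : tf.category) (N : ℕ+),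
      NH (mkOfModelCanonical X tf hZ hP IG gS gSs NH A₀ hA₀ hA₀').HodotBsFld A N →
        PadicKummer.IsNHSaturated (ctx A) N)
    (harith : ∀ (A'' : tf.category), (A''.base ⟶ A₀.base) → PreFrobenioid.IsFrobeniusTrivial tf.toElem A'' →
      ∃ (L : IntermediateField K (AlgebraicClosure K)) (_ : FiniteDimensional K L) (_ : Normal K L),
        galFixing K L ≤ H ∧ Nonempty (PadicKummer.Def22Context.Iso (ctx A'')
          (PadicKummer.Def22Context.ofLocalField L H hH (PadicKummer.boxStableSubmonoid K L fs))))
    (ιO : ∀ A : tf.category, (ctx A).O →* tf.ratFnFunctor.obj (op A.base))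
    (hconst : ∀ (A'' : tf.category) (g : A''.base ⟶ A₀.base) (ξ : tf.ratFnFunctor.obj (op A₀.base)),
      PreFrobenioid.IsFrobeniusTrivial tf.toElem A'' →
      divB tf.divisorMonoid tf.ratFnFunctor tf.divBNatTrans (op A₀.base) ξ = 1 →
        ∃ f : (ctx A'').O, (∀ h : (ctx A'').HA, (h : (ctx A'').AutE) • f = f) ∧
          ιO A'' f = pull tf.ratFnFunctor g ξ) :
    (mkOfModelCanonical X tf hZ hP IG gS gSs NH A₀ hA₀ hA₀').Prop42_iv (fun φ x => tf.pullFracModel φ x) :=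
  prop42_iv_mkOfModelCanonical_of_constantRoots X tf hZ hP IG gS gSs NH A₀ hA₀ hA₀' hΦd
    (Prop42Sub.constantRoots_of_def22Reading_arith (mkOfModelCanonical X tf hZ hP IG gS gSs NH A₀ hA₀ hA₀')
      H hH fs ctx hNH harith ιO hconst)

end Canonical

end Arithmetic

end BiKummerSetting

end Literature.AnabelianGeometry.EtaleTheta
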